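import Summits.CriticalPhenomena.PercolationContinuityZ3.Theorems.Transplant.SkelKitsHab
import Summits.CriticalPhenomena.PercolationContinuityZ3.Theorems.Transplant.SkelConcKits
import HarnessLib

/-!
# L5.15-Ω of the general node (`HOME/SHEAR-SCOPE.md` §3.9/§3.10): the PER-CONTACT DICHOTOMY `hcon` of the habitat kit clause
# `SkelI.kitClauseHab` / `kitClause_cubeHab` (`SkelKitsHab`, p3-g5) — Ω-run of hp-8 g24's `SkelI.hcon_win₂'` / `hcon_win₂_of_room'`
# (`SkelConcKits`) over the PADDED deep-slab kit (`SkelI.habPad`, `SkelWinSeedKitHab`); design ruling p3-g5, lane INBOX 2026-08-20 21:53:14Z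

builds on p205010 (kernel theorem, internal audit signed; external expert review pending) — nothing in this file uses p205010.
Lane `prim-bschramm`, seat `prim-bschramm-p3` (gen 5); helper file (`--supports stmt-CriticalPhenomena-4575 --as helper`); namespace
`Transplant.SkelI`, `[DecidableEq V]` binder.

The `Ω`-contacts `K_hab = ∂^{out}_{winGraphIn G Ω} winLevelIn Φ Ω lo hi j` of a habitat level with `hfull : winLevel Φ w₀ R lo hi j ⊆ Ω` come in
four kinds: PADDED (not a plain contact of the window `(w₀, R)`; face `{inNbrIn x}` at depth `≥ R` from `w₀`, `inNbrIn_not_mem_graphBall`),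
plain FAR (`inNbr x ∉ B_G(w₀, R − r₀)`, face `{inNbr x}`), plain NEAR-RIM (the cube centre is not deep: then the whole cube face lies beyond
depth `Rt − L''`, `Skel.deep_or_far`), plain DEEP.  If the target contains every habitat-level vertex beyond depth `Rt − L''` (`hTrim`) and
`Rt − L'' ≤ R − r₀`, `1 ≤ r₀ ≤ R`, the first three kinds take the face-in-target branch; the deep kind takes the route branch over `Γ := winGraphIn G Ω`.
* §1 **`hcon_hab'`** (abstract deep route, free guard margin `am`); **`hcon_hab_of_sets'`** — deep routes from a route prism `fatSeq (c x) ℓ ⊆ D`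
  and ANY octant piece `macroPiece (c x) ℓ (ψ ℓ) g ⊆ T` (`Skel.hcon_of_straight` over `winGraphIn G Ω`; `D ⊆ Ω` makes the prism's `G`-edges
  `Γ`-edges), so both quarter-face rooms (`SkelRoom` §3) and orthant rooms (p2-g5's `SkelConcKitsOrthant`) plug in;
* §2 **`kitClause_cubeHab_of_sets`** — `kitClause_cubeHab` with `hcon` discharged by `hcon_hab_of_sets'`: the (C) corridor residue's per-level
  kit clause modulo inputs, the nine slab/cube constants, `hfull`, the subbox weighting of the habitat graph, `winLevelIn ⊆ D ⊆ Ω`, the rim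
  target, the counts and the per-deep-contact room sets.
[cite: KozmaNitzan2024, §4 Lemma 10 Steps III–IV (pp. 19–21), Lemma 11 (p. 22), Lemma 12 (p. 24: edge faces)]
-/

noncomputable section

open MeasureTheory
open scoped Classical

namespace Summit.CriticalPhenomena.PercolationContinuityZ3.Theorems
namespace Transplant
namespace SkelI

open Literature.Probability.Percolation Literature.Probability.LatticeModels SimpleGraph KNLevels KozmaNitzan
open Literature.Probability.Percolation.GM (HOct)
open Literature.Barriers.CriticalPhenomena (graphBall graphBall_finite mem_graphBall_self graphBall_mono)
open Skel (winGraph winGraph_adj winLevel mem_winLevel_iff inNbr KitGeom fatSeq macroPiece fatRadius cubeCtr cubeFace faceElt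
  mem_fatSeq_iff cubeFace_subset_fatSeq mem_graphBall_of_mem_fatSeq winGraphIn winGraphIn_adj winGraphIn_le winLevelIn mem_winLevelIn_iff
  winLDataIn winLDataIn_X mem_outerBoundary_winIn_iff)

variable {V : Type} [DecidableEq V] {G : SimpleGraph V} [G.LocallyFinite] (Φ : PlanarSkeletonConc G)

/-! ## §1 The dichotomy over the habitat contacts -/

section Dichotomy

variable [Countable V] {p : unitInterval} (hC : Φ.toPlanarSkeleton.CylSubcritical p) {msel : V → ℕ} {Ssc : Finset ℕ} {q : unitInterval}
  {δ : ℝ} {M : ℕ} {w₀ : V} {R : ℕ} {lo hi : Site 2} {j ℓs R' r₀ rs cU : ℕ} {Wt : Sym2 V → unitInterval} {D T : Finset V}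
  {Rt L'' Ldeep : ℕ} {Unear : V → Finset V} {Ω : Finset V}

/-- **The per-contact dichotomy `hcon` of `SkelI.kitClauseHab` for a habitat level with true target + rim, deep contacts by an abstract ROUTE
hypothesis over `winGraphIn G Ω` under deepness** (Ω-run of `hcon_win₂'`): padded contacts, far plain contacts and near-rim plain contacts have a
face vertex in the rim part of the target (`hTrim` over the habitat level; `hfull` moves plain level vertices there); deep plain contacts
take the route clause with the free guard margin `am`. [cite: KozmaNitzan2024, §4 Lemma 10 Step IV (pp. 19–21), Lemma 12 (p. 24)] -/
theorem hcon_hab' {am : ℝ}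
    (hUdef : ∀ x ∈ outerBoundary (winGraph G w₀ R) (winLevel Φ w₀ R lo hi j),
      inNbr Φ w₀ R (Finset.Icc (lo - (j : Site 2)) (hi + (j : Site 2))) x ∈ graphBall G w₀ (R - r₀) →
      Unear x = cubeFace Φ hC (deepCtr Φ w₀ R (lo - (j : Site 2)) (hi + (j : Site 2)) ℓs M x)
        (exitDir Φ w₀ R (lo - (j : Site 2)) (hi + (j : Site 2)) x).1 (exitDir Φ w₀ R (lo - (j : Site 2)) (hi + (j : Site 2)) x).2 ℓs M)
    (hU : NearFaceOKDeep Φ w₀ R lo hi j ℓs M R' r₀ rs cU Unear) (hfull : winLevel Φ w₀ R lo hi j ⊆ Ω) (hr₀ : 1 ≤ r₀) (hR : r₀ ≤ R)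
    (hTrim : ∀ v ∈ winLevelIn Φ Ω lo hi j, v ∉ graphBall G w₀ (Rt - L'') → v ∈ T) (hRL : Rt - L'' ≤ R - r₀)
    (hL : Ldeep + fatRadius Φ hC M ≤ L'') (hLR : L'' ≤ Rt)
    (hroute : ∀ x ∈ outerBoundary (winGraph G w₀ R) (winLevel Φ w₀ R lo hi j),
      inNbr Φ w₀ R (Finset.Icc (lo - (j : Site 2)) (hi + (j : Site 2))) x ∈ graphBall G w₀ (R - r₀) →
      graphBall G (cubeCtr Φ (deepCtr Φ w₀ R (lo - (j : Site 2)) (hi + (j : Site 2)) ℓs M x) (exitDir Φ w₀ R (lo - (j : Site 2)) (hi + (j : Site 2)) x).1 (exitDir Φ w₀ R (lo - (j : Site 2)) (hi + (j : Site 2)) x).2 ℓs M) Ldeep ⊆ graphBall G w₀ Rt →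
      ∀ t ∈ Φ.types,
        (∀ M' ∈ Ssc, 1 - am < (bondPercolation G q).real (UniqZone.zone G (fatSeq Φ hC (cubeCtr Φ (deepCtr Φ w₀ R (lo - (j : Site 2)) (hi + (j : Site 2)) ℓs M x) (exitDir Φ w₀ R (lo - (j : Site 2)) (hi + (j : Site 2)) x).1 (exitDir Φ w₀ R (lo - (j : Site 2)) (hi + (j : Site 2)) x).2 ℓs M)) (msel t) M') ∧
          ∀ g' : HOct 2, 1 - am < (bondPercolation G q).real
            (linkIn (↑(fatSeq Φ hC (cubeCtr Φ (deepCtr Φ w₀ R (lo - (j : Site 2)) (hi + (j : Site 2)) ℓs M x) (exitDir Φ w₀ R (lo - (j : Site 2)) (hi + (j : Site 2)) x).1 (exitDir Φ w₀ R (lo - (j : Site 2)) (hi + (j : Site 2)) x).2 ℓs M) M')) (fatSeq Φ hC (cubeCtr Φ (deepCtr Φ w₀ R (lo - (j : Site 2)) (hi + (j : Site 2)) ℓs M x) (exitDir Φ w₀ R (lo - (j : Site 2)) (hi + (j : Site 2)) x).1 (exitDir Φ w₀ R (lo - (j : Site 2)) (hi + (j : Site 2)) x).2 ℓs M) (msel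 t)) (macroPiece Φ (cubeCtr Φ (deepCtr Φ w₀ R (lo - (j : Site 2)) (hi + (j : Site 2)) ℓs M x) (exitDir Φ w₀ R (lo - (j : Site 2)) (hi + (j : Site 2)) x).1 (exitDir Φ w₀ R (lo - (j : Site 2)) (hi + (j : Site 2)) x).2 ℓs M) M' (fatRadius Φ hC M') g'))) →
        ∃ Qt Ft : Finset V, Ft ⊆ T ∧ Qt ⊆ D ∧ (∀ u ∈ Qt, ∀ v ∈ Qt, G.Adj u v → (winGraphIn G Ω).Adj u v) ∧
          Disjoint Ft (fatSeq Φ hC (cubeCtr Φ (deepCtr Φ w₀ R (lo - (j : Site 2)) (hi + (j : Site 2)) ℓs M x) (exitDir Φ w₀ R (lo - (j : Site 2)) (hi + (j : Site 2)) x).1 (exitDir Φ w₀ R (lo - (j : Site 2)) (hi + (j : Site 2)) x).2 ℓs M) M) ∧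
          1 - δ ^ 2 < (prodBernoulli Wt).real (linkIn (↑Qt) (fatSeq Φ hC (cubeCtr Φ (deepCtr Φ w₀ R (lo - (j : Site 2)) (hi + (j : Site 2)) ℓs M x) (exitDir Φ w₀ R (lo - (j : Site 2)) (hi + (j : Site 2)) x).1 (exitDir Φ w₀ R (lo - (j : Site 2)) (hi + (j : Site 2)) x).2 ℓs M) (msel t)) Ft)) :
    ∀ x ∈ outerBoundary (winGraphIn G Ω) (winLevelIn Φ Ω lo hi j),
      (∃ u ∈ (habPad Φ Ω w₀ R lo hi j (slabGeomDeep Φ w₀ R lo hi j ℓs M R' r₀ Unear)).U x, u ∈ T) ∨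
      (x ∈ outerBoundary (winGraph G w₀ R) (winLevel Φ w₀ R lo hi j) ∧
        inNbr Φ w₀ R (Finset.Icc (lo - (j : Site 2)) (hi + (j : Site 2))) x ∈ graphBall G w₀ (R - r₀) ∧ ∀ t ∈ Φ.types,
        (∀ M' ∈ Ssc, 1 - am < (bondPercolation G q).real (UniqZone.zone G (fatSeq Φ hC (cubeCtr Φ (deepCtr Φ w₀ R (lo - (j : Site 2)) (hi + (j : Site 2)) ℓs M x) (exitDir Φ w₀ R (lo - (j : Site 2)) (hi + (j : Site 2)) x).1 (exitDir Φ w₀ R (lo - (j : Site 2)) (hi + (j : Site 2)) x).2 ℓs M)) (msel t) M') ∧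
          ∀ g' : HOct 2, 1 - am < (bondPercolation G q).real
            (linkIn (↑(fatSeq Φ hC (cubeCtr Φ (deepCtr Φ w₀ R (lo - (j : Site 2)) (hi + (j : Site 2)) ℓs M x) (exitDir Φ w₀ R (lo - (j : Site 2)) (hi + (j : Site 2)) x).1 (exitDir Φ w₀ R (lo - (j : Site 2)) (hi + (j : Site 2)) x).2 ℓs M) M')) (fatSeq Φ hC (cubeCtr Φ (deepCtr Φ w₀ R (lo - (j : Site 2)) (hi + (j : Site 2)) ℓs M x) (exitDir Φ w₀ R (lo - (j : Site 2)) (hi + (j : Site 2)) x).1 (exitDir Φ w₀ R (lo - (j : Site 2)) (hi + (j : Site 2)) x).2 ℓs M) (msel t)) (macroPiece Φ (cubeCtr Φ (deepCtr Φ w₀ R (lo - (j : Site 2)) (hi + (j : Site 2)) ℓs M x) (exitDir Φ w₀ R (lo - (j : Site 2)) (hi + (j : Site 2)) x).1 (exitDir Φ w₀ R (lo - (j : Site 2)) (hi + (j : Site 2)) x).2 ℓs M) M' (fatRadius Φ hC M') g'))) →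
        ∃ Qt Ft : Finset V, Ft ⊆ T ∧ Qt ⊆ D ∧ (∀ u ∈ Qt, ∀ v ∈ Qt, G.Adj u v → (winGraphIn G Ω).Adj u v) ∧
          Disjoint Ft (fatSeq Φ hC (cubeCtr Φ (deepCtr Φ w₀ R (lo - (j : Site 2)) (hi + (j : Site 2)) ℓs M x) (exitDir Φ w₀ R (lo - (j : Site 2)) (hi + (j : Site 2)) x).1 (exitDir Φ w₀ R (lo - (j : Site 2)) (hi + (j : Site 2)) x).2 ℓs M) M) ∧
          1 - δ ^ 2 < (prodBernoulli Wt).real (linkIn (↑Qt) (fatSeq Φ hC (cubeCtr Φ (deepCtr Φ w₀ R (lo - (j : Site 2)) (hi + (j : Site 2)) ℓs M x) (exitDir Φ w₀ R (lo - (j : Site 2)) (hi + (j : Site 2)) x).1 (exitDir Φ w₀ R (lo - (j : Site 2)) (hi + (j : Site 2)) x).2 ℓs M) (msel t)) Ft)) := by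
  intro x hx
  by_cases hp : x ∈ outerBoundary (winGraph G w₀ R) (winLevel Φ w₀ R lo hi j)
  · by_cases hnear : inNbr Φ w₀ R (Finset.Icc (lo - (j : Site 2)) (hi + (j : Site 2))) x ∈ graphBall G w₀ (R - r₀)
    · by_cases hdeep : graphBall G (cubeCtr Φ (deepCtr Φ w₀ R (lo - (j : Site 2)) (hi + (j : Site 2)) ℓs M x) (exitDir Φ w₀ R (lo - (j : Site 2)) (hi + (j : Site 2)) x).1 (exitDir Φ w₀ R (lo - (j : Site 2)) (hi + (j : Site 2)) x).2 ℓs M) Ldeep ⊆ graphBall G w₀ Rt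
      · exact Or.inr ⟨hp, hnear, fun t ht hin => hroute x hp hnear hdeep t ht hin⟩
      · -- near but not deep: the whole cube face lies in the rim
        left
        obtain ⟨u, hu⟩ := cubeFace_nonempty Φ hC (deepCtr Φ w₀ R (lo - (j : Site 2)) (hi + (j : Site 2)) ℓs M x)
          (exitDir Φ w₀ R (lo - (j : Site 2)) (hi + (j : Site 2)) x).1 (exitDir Φ w₀ R (lo - (j : Site 2)) (hi + (j : Site 2)) x).2 ℓs M
        have hUx : (habPad Φ Ω w₀ R lo hi j (slabGeomDeep Φ w₀ R lo hi j ℓs M R' r₀ Unear)).U x = Unear x := by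
          rw [(habPad_of_mem hp).2.2]
          simp only [slabGeomDeep, if_pos hnear]
        have hu' : u ∈ Unear x := by rw [hUdef x hp hnear]; exact hu
        refine ⟨u, by rw [hUx]; exact hu', hTrim u (winLevel_subset_winLevelIn hfull (hU.sub x hp hnear hu')) fun hub => ?_⟩
        rcases Skel.deep_or_far G (cubeCtr Φ (deepCtr Φ w₀ R (lo - (j : Site 2)) (hi + (j : Site 2)) ℓs M x) (exitDir Φ w₀ R (lo - (j : Site 2)) (hi + (j : Site 2)) x).1 (exitDir Φ w₀ R (lo - (j : Site 2)) (hi + (j : Site 2)) x).2 ℓs M) hL hLR with h | h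
        · exact hdeep h
        · exact Set.disjoint_left.1 h (mem_graphBall_of_mem_fatSeq Φ hC (cubeFace_subset_fatSeq Φ hC _ _ _ _ _ hu)) hub
    · -- far plain contact: its inner neighbour is a rim vertex
      left
      have hp' : x ∈ outerBoundary (winGraph G w₀ R) (Φ.Win w₀ (Finset.Icc (lo - (j : Site 2)) (hi + (j : Site 2))) R) := hp
      have hy := inNbr_spec Φ hp'
      have hUx : (habPad Φ Ω w₀ R lo hi j (slabGeomDeep Φ w₀ R lo hi j ℓs M R' r₀ Unear)).U x = {inNbr Φ w₀ R (Finset.Icc (lo - (j : Site 2)) (hi + (j : Site 2))) x} := by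
        rw [(habPad_of_mem hp).2.2]
        simp only [slabGeomDeep, if_neg hnear]
      refine ⟨inNbr Φ w₀ R (Finset.Icc (lo - (j : Site 2)) (hi + (j : Site 2))) x, by rw [hUx]; exact Finset.mem_singleton_self _,
        hTrim _ ?_ fun hyb => hnear (graphBall_mono G w₀ hRL hyb)⟩
      exact winLevel_subset_winLevelIn hfull ((mem_winLevel_iff Φ).2 ⟨hy.2.1, hy.2.2⟩)
  · -- padded contact: its inner `Ω`-neighbour lies at depth `≥ R`
    left
    refine ⟨inNbrIn Φ Ω (Finset.Icc (lo - (j : Site 2)) (hi + (j : Site 2))) x, by rw [(habPad_of_not_mem hp).2.2]; exact Finset.mem_singleton_self _,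
      hTrim _ (inNbrIn_mem_winLevelIn Φ hx) (inNbrIn_not_mem_graphBall hx hp (by omega))⟩

/-- **The per-contact dichotomy for a habitat level with true target + rim and STRAIGHT deep routes from ROOM SETS** (corridor / root / inner
steps over the habitat): for every deep plain contact a route scale `ℓ ∈ Ssc`, `M < ℓ`, with the route prism `fatSeq (c x) ℓ ⊆ D` and SOME octant
piece `macroPiece (c x) ℓ (ψ ℓ) g ⊆ T`; `D ⊆ Ω` makes the prism's edges habitat edges.  Guard margin `am ≤ δ²`.
[cite: KozmaNitzan2024, §4 Lemma 10 Step IV (p. 20), Lemma 11 (p. 23)] -/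
theorem hcon_hab_of_sets' {am : ℝ} (ha : am ≤ δ ^ 2)
    (hUdef : ∀ x ∈ outerBoundary (winGraph G w₀ R) (winLevel Φ w₀ R lo hi j),
      inNbr Φ w₀ R (Finset.Icc (lo - (j : Site 2)) (hi + (j : Site 2))) x ∈ graphBall G w₀ (R - r₀) →
      Unear x = cubeFace Φ hC (deepCtr Φ w₀ R (lo - (j : Site 2)) (hi + (j : Site 2)) ℓs M x)
        (exitDir Φ w₀ R (lo - (j : Site 2)) (hi + (j : Site 2)) x).1 (exitDir Φ w₀ R (lo - (j : Site 2)) (hi + (j : Site 2)) x).2 ℓs M)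
    (hU : NearFaceOKDeep Φ w₀ R lo hi j ℓs M R' r₀ rs cU Unear) (hfull : winLevel Φ w₀ R lo hi j ⊆ Ω) (hr₀ : 1 ≤ r₀) (hR : r₀ ≤ R)
    (hTrim : ∀ v ∈ winLevelIn Φ Ω lo hi j, v ∉ graphBall G w₀ (Rt - L'') → v ∈ T) (hRL : Rt - L'' ≤ R - r₀)
    (hL : Ldeep + fatRadius Φ hC M ≤ L'') (hLR : L'' ≤ Rt)
    (hWD : IsSubbox (winGraphIn G Ω) Wt q D) (hDΩ : D ⊆ Ω)
    (hroom : ∀ x ∈ outerBoundary (winGraph G w₀ R) (winLevel Φ w₀ R lo hi j),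
      inNbr Φ w₀ R (Finset.Icc (lo - (j : Site 2)) (hi + (j : Site 2))) x ∈ graphBall G w₀ (R - r₀) →
      graphBall G (cubeCtr Φ (deepCtr Φ w₀ R (lo - (j : Site 2)) (hi + (j : Site 2)) ℓs M x) (exitDir Φ w₀ R (lo - (j : Site 2)) (hi + (j : Site 2)) x).1 (exitDir Φ w₀ R (lo - (j : Site 2)) (hi + (j : Site 2)) x).2 ℓs M) Ldeep ⊆ graphBall G w₀ Rt →
      ∃ ℓ ∈ Ssc, M < ℓ ∧ fatSeq Φ hC (cubeCtr Φ (deepCtr Φ w₀ R (lo - (j : Site 2)) (hi + (j : Site 2)) ℓs M x) (exitDir Φ w₀ R (lo - (j : Site 2)) (hi + (j : Site 2)) x).1 (exitDir Φ w₀ R (lo - (j : Site 2)) (hi + (j : Site 2)) x).2 ℓs M) ℓ ⊆ D ∧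
        ∃ g : HOct 2, macroPiece Φ (cubeCtr Φ (deepCtr Φ w₀ R (lo - (j : Site 2)) (hi + (j : Site 2)) ℓs M x) (exitDir Φ w₀ R (lo - (j : Site 2)) (hi + (j : Site 2)) x).1 (exitDir Φ w₀ R (lo - (j : Site 2)) (hi + (j : Site 2)) x).2 ℓs M) ℓ (fatRadius Φ hC ℓ) g ⊆ T) :
    ∀ x ∈ outerBoundary (winGraphIn G Ω) (winLevelIn Φ Ω lo hi j),
      (∃ u ∈ (habPad Φ Ω w₀ R lo hi j (slabGeomDeep Φ w₀ R lo hi j ℓs M R' r₀ Unear)).U x, u ∈ T) ∨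
      (x ∈ outerBoundary (winGraph G w₀ R) (winLevel Φ w₀ R lo hi j) ∧
        inNbr Φ w₀ R (Finset.Icc (lo - (j : Site 2)) (hi + (j : Site 2))) x ∈ graphBall G w₀ (R - r₀) ∧ ∀ t ∈ Φ.types,
        (∀ M' ∈ Ssc, 1 - am < (bondPercolation G q).real (UniqZone.zone G (fatSeq Φ hC (cubeCtr Φ (deepCtr Φ w₀ R (lo - (j : Site 2)) (hi + (j : Site 2)) ℓs M x) (exitDir Φ w₀ R (lo - (j : Site 2)) (hi + (j : Site 2)) x).1 (exitDir Φ w₀ R (lo - (j : Site 2)) (hi + (j : Site 2)) x).2 ℓs M)) (msel t) M') ∧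
          ∀ g' : HOct 2, 1 - am < (bondPercolation G q).real
            (linkIn (↑(fatSeq Φ hC (cubeCtr Φ (deepCtr Φ w₀ R (lo - (j : Site 2)) (hi + (j : Site 2)) ℓs M x) (exitDir Φ w₀ R (lo - (j : Site 2)) (hi + (j : Site 2)) x).1 (exitDir Φ w₀ R (lo - (j : Site 2)) (hi + (j : Site 2)) x).2 ℓs M) M')) (fatSeq Φ hC (cubeCtr Φ (deepCtr Φ w₀ R (lo - (j : Site 2)) (hi + (j : Site 2)) ℓs M x) (exitDir Φ w₀ R (lo - (j : Site 2)) (hi + (j : Site 2)) x).1 (exitDir Φ w₀ R (lo - (j : Site 2)) (hi + (j : Site 2)) x).2 ℓs M) (msel t)) (macroPiece Φ (cubeCtr Φ (deepCtr Φ w₀ R (lo - (j : Site 2)) (hi + (j : Site 2)) ℓs M x) (exitDir Φ w₀ R (lo - (j : Site 2)) (hi + (j : Site 2)) x).1 (exitDir Φ w₀ R (lo - (j : Site 2)) (hi + (j : Site 2)) x).2 ℓs M) M' (fatRadius Φ hC M') g'))) →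
        ∃ Qt Ft : Finset V, Ft ⊆ T ∧ Qt ⊆ D ∧ (∀ u ∈ Qt, ∀ v ∈ Qt, G.Adj u v → (winGraphIn G Ω).Adj u v) ∧
          Disjoint Ft (fatSeq Φ hC (cubeCtr Φ (deepCtr Φ w₀ R (lo - (j : Site 2)) (hi + (j : Site 2)) ℓs M x) (exitDir Φ w₀ R (lo - (j : Site 2)) (hi + (j : Site 2)) x).1 (exitDir Φ w₀ R (lo - (j : Site 2)) (hi + (j : Site 2)) x).2 ℓs M) M) ∧
          1 - δ ^ 2 < (prodBernoulli Wt).real (linkIn (↑Qt) (fatSeq Φ hC (cubeCtr Φ (deepCtr Φ w₀ R (lo - (j : Site 2)) (hi + (j : Site 2)) ℓs M x) (exitDir Φ w₀ R (lo - (j : Site 2)) (hi + (j : Site 2)) x).1 (exitDir Φ w₀ R (lo - (j : Site 2)) (hi + (j : Site 2)) x).2 ℓs M) (msel t)) Ft)) := by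
  refine hcon_hab' Φ hC hUdef hU hfull hr₀ hR hTrim hRL hL hLR fun x hx hnear hdeep t _ hin => ?_
  obtain ⟨ℓ, hℓ, hMℓ, hQD, g, hT⟩ := hroom x hx hnear hdeep
  obtain ⟨Qt, Ft, h1, h2, h3, h4, h5⟩ := Skel.hcon_of_straight Φ hC (winGraphIn_le G Ω) hWD hℓ hMℓ hQD
    (Skel.adj_winGraphIn_of_subset (hQD.trans hDΩ)) hT hin
  exact ⟨Qt, Ft, h1, h2, h3, h4, (sub_le_sub_left ha 1).trans_lt h5⟩

end Dichotomy

/-! ## §2 The habitat kit clause with cube faces and straight routes -/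

/-- **The kit clause of a habitat level with cube faces and straight deep routes from room sets** (`kitClause_cubeHab` ∘ `hcon_hab_of_sets'`):
the per-level `hkits` of the corridor residue (C) modulo the input family (free margin `a ≤ δ²`), the nine slab/cube constants, `hfull`,
`IsSubbox (winGraphIn G Ω) Wt q D`, `winLevelIn ⊆ D ⊆ Ω`, the rim part of the target (`hTrim`, `Rt − L'' ≤ R − r₀`, `Ldeep + ψ M ≤ L'' ≤ Rt`),
the counts, and for every deep plain contact a route prism in `D` with an octant piece in `T`.
[cite: KozmaNitzan2024, §4 Lemma 10, Steps III–IV (pp. 19–21), Lemma 11 (p. 23)] -/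
theorem kitClause_cubeHab_of_sets [Countable V] {p : unitInterval} (hC : Φ.toPlanarSkeleton.CylSubcritical p) (msel : V → ℕ)
    {Ssc : Finset ℕ} {q : unitInterval} {δ a : ℝ} (hδ : 0 < δ) (ha : a ≤ δ ^ 2)
    (hin : ∀ i ∈ Skel.inputIndex Φ Ssc, 1 - a < (bondPercolation G q).real (Skel.inputEvent Φ hC msel i))
    {M : ℕ} (hM : M ∈ Ssc) (hmsel : ∀ t ∈ Φ.types, msel t ≤ M)
    {w₀ : V} {R : ℕ} {lo hi : Site 2} {j ℓs R' r₀ rs : ℕ} (hMℓ : M + 1 ≤ ℓs)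
    (hwide : ∀ i, (lo - (j : Site 2)) i + 2 * tanOff ℓs M ≤ (hi + (j : Site 2)) i)
    (hR'₁ : Φ.cylRadMax ℓs (ℓs + 2 + 2 * tanOff ℓs M) ≤ R') (hR'₂ : Φ.cylRadMax ℓs (ℓs + 2 + M + fatRadius Φ hC M) ≤ R')
    (hr₀₁ : ℓs + 1 + tanOff ℓs M + R' ≤ r₀) (hr₀₂ : 2 * ℓs + 2 + tanOff ℓs M + M + fatRadius Φ hC M ≤ r₀) (hR : r₀ ≤ R)
    (hrs₁ : ℓs + 2 + tanOff ℓs M + R' ≤ rs) (hrs₂ : 2 * ℓs + 3 + tanOff ℓs M + M + fatRadius Φ hC M ≤ rs)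
    {Ω : Finset V} (hfull : winLevel Φ w₀ R lo hi j ⊆ Ω)
    (k : ℕ) (o : V) (Sfin : Finset V) {Wt : Sym2 V → unitInterval} {D T : Finset V}
    (hWD : IsSubbox (winGraphIn G Ω) Wt q D) (hXD : winLevelIn Φ Ω lo hi j ⊆ D) (hDΩ : D ⊆ Ω) {N : ℕ}
    (hN : k * (Φ.Δ + 1) ^ (2 * rs) ≤ N)
    (hk : (1 - (q : ℝ) ^ (1 + Φ.Δ * ((Φ.Δ + 1) ^ R' + (tanOff ℓs M + 2)) +
      ((Φ.Δ + 1) ^ R' + (tanOff ℓs M + 2)) * (Φ.Δ + 1) ^ fatRadius Φ hC M)) ^ k ≤ δ)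
    {Rt L'' Ldeep : ℕ} (hTrim : ∀ v ∈ winLevelIn Φ Ω lo hi j, v ∉ graphBall G w₀ (Rt - L'') → v ∈ T) (hRL : Rt - L'' ≤ R - r₀)
    (hL : Ldeep + fatRadius Φ hC M ≤ L'') (hLR : L'' ≤ Rt)
    (hroom : ∀ x ∈ outerBoundary (winGraph G w₀ R) (winLevel Φ w₀ R lo hi j),
      inNbr Φ w₀ R (Finset.Icc (lo - (j : Site 2)) (hi + (j : Site 2))) x ∈ graphBall G w₀ (R - r₀) →
      graphBall G (cubeCtr Φ (deepCtr Φ w₀ R (lo - (j : Site 2)) (hi + (j : Site 2)) ℓs M x) (exitDir Φ w₀ R (lo - (j : Site 2)) (hi + (j : Site 2)) x).1 (exitDir Φ w₀ R (lo - (j : Site 2)) (hi + (j : Site 2)) x).2 ℓs M) Ldeep ⊆ graphBall G w₀ Rt →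
      ∃ ℓ ∈ Ssc, M < ℓ ∧ fatSeq Φ hC (cubeCtr Φ (deepCtr Φ w₀ R (lo - (j : Site 2)) (hi + (j : Site 2)) ℓs M x) (exitDir Φ w₀ R (lo - (j : Site 2)) (hi + (j : Site 2)) x).1 (exitDir Φ w₀ R (lo - (j : Site 2)) (hi + (j : Site 2)) x).2 ℓs M) ℓ ⊆ D ∧
        ∃ g : HOct 2, macroPiece Φ (cubeCtr Φ (deepCtr Φ w₀ R (lo - (j : Site 2)) (hi + (j : Site 2)) ℓs M x) (exitDir Φ w₀ R (lo - (j : Site 2)) (hi + (j : Site 2)) x).1 (exitDir Φ w₀ R (lo - (j : Site 2)) (hi + (j : Site 2)) x).2 ℓs M) ℓ (fatRadius Φ hC ℓ) g ⊆ T) :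
    ∃ (σ : SData V) (S : Finset V), SHyp (winLDataIn Φ Ω lo hi o Sfin) j σ ∧ σ.N ≤ N ∧
      (1 - (q : ℝ) ^ σ.sB) ^ σ.k ≤ δ ∧ S ⊆ (winLDataIn Φ Ω lo hi o Sfin).X j ∧ S ⊆ D ∧
      (∀ x ∈ σ.K, ∀ e ∈ σ.seed x, e ∉ wireSet (↑S : Set V)) ∧ (∀ x ∈ σ.K, σ.face x ⊆ S) ∧
      (∀ x ∈ σ.K, 1 - 3 * δ ≤ (prodBernoulli Wt).real {ω | ∃ u ∈ σ.face x,
        1 - δ < (prodBernoulli (pinW Wt (wireSet (↑S : Set V)) ω)).real (⋃ t ∈ T, openConnIn (↑D : Set V) u t)}) := by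
  have hr₀ : 1 ≤ r₀ := by omega
  exact kitClause_cubeHab Φ hC msel hδ ha hin hM hmsel hMℓ hwide hR'₁ hR'₂ hr₀₁ hr₀₂ hR hrs₁ hrs₂ hfull k o Sfin hWD hXD hN hk
    (hcon_hab_of_sets' Φ hC ha (fun x _ _ => rfl) (nearFaceOK_cube Φ hC (w₀ := w₀) hMℓ hwide hR'₂ hr₀₂ hR hrs₂ le_rfl) hfull hr₀ hR
      hTrim hRL hL hLR hWD hDΩ hroom)

end SkelI
end Transplant
end Summit.CriticalPhenomena.PercolationContinuityZ3.Theorems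

end
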